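import Summits.AtomisticToContinuum.Crystallization.Theorems.FrustratedLawDichotomyStrainedPatchHomForceKit
import Literature.Analysis.ValidatedNumerics.FixedPointIntervalSqrt

/-!
# Per-label CURVATURE COEFFICIENTS `α, β` of the record potential in the kernel (fixed-point intervals), regimes LJ and BUMP

decomp-a2c hand-1 g26 (crux `AperiodicFrustratedLawGap`, stmt-AtomisticToContinuum-27623; `(H) HomFloor (1/625)`, hcp half; the `λ`-leaf of lever (C),
critic rows 1026 (C) / 1030).  `…HomConvexCurvature` / `…HomCurvKit` reduce the curvature certificate to per-label enclosures of
`β = W₄₅′(ρ)/ρ` and `α = (W₄₅″(ρ) − W₄₅′(ρ)/ρ)/ρ²` (`ρ = ‖c_b‖`, `q = ρ²`).  With `…HomWrecCurvature`'s closed forms these are, per open regime,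
explicit in `q`, `q⁻¹` and `ρ = √q`:

* Lennard-Jones `8/5 < ρ < 3`: `β = q⁻⁴ − q⁻⁷` (hand-2's `phiFI`), `α = 14q⁻⁸ − 8q⁻⁵` (`alphaLJFI`);
* bump `0 < ρ < 8/5` (first and second shells): `β = (q⁻⁴ − q⁻⁷) − (3/160)·(5/4)·S(w)`, `α = (14q⁻⁸ − 8q⁻⁵) − (3/160)·((5/4)·P₂(w) − (5/4)·S(w))·q⁻¹`,
  `w = 5ρ/4`, `S(w) = −11/3 + 33/4w² − 385/64w³ + 231/256w⁵ − 99/1024w⁷ + 55/12288w⁹` (`= P′(w)/w`), `P₂ = P″`.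

This file: the FI-valued enclosure functions and their `FI.mem` soundness against exactly these real expressions (§1 LJ, §2 bump); the regime
DISPATCH against the landed closed forms of `deriv Wrec`, `deriv (deriv Wrec)` and the window regime follow in the sequel.  Kernel definitions
(FI-valued) + soundness; 0 sorry; standard axioms; no instances / notation / `#eval`.  `--supports stmt-AtomisticToContinuum-27623`.
-/

noncomputable section

namespace Summit.AtomisticToContinuum.Crystallization.Theorems.FrustratedLawDichotomyStrainedPatchHomCurvCoeff

open Literature.Analysis.ValidatedNumerics.Numerics
open Summit.AtomisticToContinuum.Crystallization.Theorems.FrustratedLawDichotomyStrainedPatchHomForceKit (phiFI mem_phiFI)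

/-! ## §1. Lennard-Jones regime: `α = 14q⁻⁸ − 8q⁻⁵` -/

/-- `14·(Q⁻¹)⁸ − 8·(Q⁻¹)⁵` in the kernel (`none` iff the enclosure of `Q` reaches `0`). -/
def alphaLJFI (Q : FI) : Option FI :=
  match FI.divPos (FI.ofInt 1) Q with
  | none => none
  | some u =>
    let u2 := u.mul u
    let u4 := u2.mul u2
    let u8 := u4.mul u4
    let u5 := u4.mul u
    some ((u8.mulInt 14).sub (u5.mulInt 8))

/-- `alphaLJFI` encloses `14(q⁻¹)⁸ − 8(q⁻¹)⁵`. [folklore] -/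
theorem mem_alphaLJFI {q : ℝ} {Q A : FI} (hq : FI.mem q Q) (h : alphaLJFI Q = some A) :
    FI.mem (14 * (q⁻¹) ^ 8 - 8 * (q⁻¹) ^ 5) A := by
  unfold alphaLJFI at h
  cases hdiv : FI.divPos (FI.ofInt 1) Q with
  | none => rw [hdiv] at h; exact absurd h (by simp)
  | some u =>
    rw [hdiv] at h
    simp only [Option.some.injEq] at h
    subst h
    have hu : FI.mem (q⁻¹) u := by
      have := FI.mem_divPos hdiv (by simpa using FI.mem_ofInt 1) hq
      simpa [one_div] using this
    have hu2 : FI.mem (q⁻¹ ^ 2) (u.mul u) := by rw [pow_two]; exact FI.mem_mul hu hu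
    have hu4 : FI.mem (q⁻¹ ^ 4) ((u.mul u).mul (u.mul u)) := by
      rw [show q⁻¹ ^ 4 = q⁻¹ ^ 2 * q⁻¹ ^ 2 by ring]; exact FI.mem_mul hu2 hu2
    have hu8 : FI.mem (q⁻¹ ^ 8) (((u.mul u).mul (u.mul u)).mul ((u.mul u).mul (u.mul u))) := by
      rw [show q⁻¹ ^ 8 = q⁻¹ ^ 4 * q⁻¹ ^ 4 by ring]; exact FI.mem_mul hu4 hu4
    have hu5 : FI.mem (q⁻¹ ^ 5) (((u.mul u).mul (u.mul u)).mul u) := by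
      rw [show q⁻¹ ^ 5 = q⁻¹ ^ 4 * q⁻¹ by ring]; exact FI.mem_mul hu4 hu
    have h14 := FI.mem_mulInt hu8 14
    have h8 := FI.mem_mulInt hu5 8
    have := FI.mem_sub h14 h8
    push_cast at this
    simpa [mul_comm] using this

/-! ## §2. Bump regime: the profile polynomials in `w = 5ρ/4` -/

/-- `w = 5ρ/4` from an enclosure `R ∋ ρ`. -/
def wFI (R : FI) : FI := (R.mulInt 5).divNat 4

/-- [folklore] -/
theorem mem_wFI {ρ : ℝ} {R : FI} (h : FI.mem ρ R) : FI.mem (5 * ρ / 4) (wFI R) := by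
  have := FI.mem_divNat (FI.mem_mulInt h 5) (n := 4) (by norm_num)
  push_cast at this
  simpa [wFI, mul_comm] using this

/-- `(5/4)·S(w)`, `S(w) = −11/3 + 33/4w² − 385/64w³ + 231/256w⁵ − 99/1024w⁷ + 55/12288w⁹` (Horner in `w`, `w²`). -/
def bumpS54FI (W : FI) : FI :=
  let w2 := W.mul W
  let t9 := FI.ofFrac 55 12288
  let t7 := (FI.ofFrac (-99) 1024).add (w2.mul t9)
  let t5 := (FI.ofFrac 231 256).add (w2.mul t7)
  let t3 := (FI.ofFrac (-385) 64).add (w2.mul t5)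
  let t2 := (FI.ofFrac 33 4).add (W.mul t3)
  let s := (FI.ofFrac (-11) 3).add (w2.mul t2)
  (s.mulInt 5).divNat 4

/-- [folklore] -/
theorem mem_bumpS54FI {w : ℝ} {W : FI} (h : FI.mem w W) :
    FI.mem (5 / 4 * (-(11 / 3) + 33 / 4 * w ^ 2 - 385 / 64 * w ^ 3 + 231 / 256 * w ^ 5 - 99 / 1024 * w ^ 7 + 55 / 12288 * w ^ 9))
      (bumpS54FI W) := by
  have hw2 : FI.mem (w * w) (W.mul W) := FI.mem_mul h h
  have h9 : FI.mem ((55 : ℤ) / (12288 : ℕ) : ℝ) (FI.ofFrac 55 12288) := FI.mem_ofFrac 55 (by norm_num)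
  have h7 := FI.mem_add (FI.mem_ofFrac (-99) (q := 1024) (by norm_num)) (FI.mem_mul hw2 h9)
  have h5 := FI.mem_add (FI.mem_ofFrac 231 (q := 256) (by norm_num)) (FI.mem_mul hw2 h7)
  have h3 := FI.mem_add (FI.mem_ofFrac (-385) (q := 64) (by norm_num)) (FI.mem_mul hw2 h5)
  have h2 := FI.mem_add (FI.mem_ofFrac 33 (q := 4) (by norm_num)) (FI.mem_mul h h3)
  have hs := FI.mem_add (FI.mem_ofFrac (-11) (q := 3) (by norm_num)) (FI.mem_mul hw2 h2)
  have hfin := FI.mem_divNat (FI.mem_mulInt hs 5) (n := 4) (by norm_num)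
  have e : (-(11 : ℤ) : ℝ) / (3 : ℕ) + w * w * ((33 : ℤ) / (4 : ℕ) + w * ((-(385 : ℤ) : ℝ) / (64 : ℕ) + w * w * ((231 : ℤ) / (256 : ℕ) +
      w * w * ((-(99 : ℤ) : ℝ) / (1024 : ℕ) + w * w * ((55 : ℤ) / (12288 : ℕ)))))) =
      -(11 / 3) + 33 / 4 * w ^ 2 - 385 / 64 * w ^ 3 + 231 / 256 * w ^ 5 - 99 / 1024 * w ^ 7 + 55 / 12288 * w ^ 9 := by
    push_cast; ring
  have e2 : ((-(11 / 3) + 33 / 4 * w ^ 2 - 385 / 64 * w ^ 3 + 231 / 256 * w ^ 5 - 99 / 1024 * w ^ 7 + 55 / 12288 * w ^ 9) * (5 : ℤ)) / (4 : ℕ) =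
      5 / 4 * (-(11 / 3) + 33 / 4 * w ^ 2 - 385 / 64 * w ^ 3 + 231 / 256 * w ^ 5 - 99 / 1024 * w ^ 7 + 55 / 12288 * w ^ 9) := by
    push_cast; ring
  rw [← e2, ← e]
  simpa [bumpS54FI] using hfin

/-- `(5/4)·P₂(w)`, `P₂(w) = −11/3 + 99/4w² − 385/16w³ + 693/128w⁵ − 99/128w⁷ + 275/6144w⁹` (Horner). -/
def bumpP54FI (W : FI) : FI :=
  let w2 := W.mul W
  let t9 := FI.ofFrac 275 6144
  let t7 := (FI.ofFrac (-99) 128).add (w2.mul t9)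
  let t5 := (FI.ofFrac 693 128).add (w2.mul t7)
  let t3 := (FI.ofFrac (-385) 16).add (w2.mul t5)
  let t2 := (FI.ofFrac 99 4).add (W.mul t3)
  let s := (FI.ofFrac (-11) 3).add (w2.mul t2)
  (s.mulInt 5).divNat 4

/-- [folklore] -/
theorem mem_bumpP54FI {w : ℝ} {W : FI} (h : FI.mem w W) :
    FI.mem (5 / 4 * (-(11 / 3) + 99 / 4 * w ^ 2 - 385 / 16 * w ^ 3 + 693 / 128 * w ^ 5 - 99 / 128 * w ^ 7 + 275 / 6144 * w ^ 9))
      (bumpP54FI W) := by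
  have hw2 : FI.mem (w * w) (W.mul W) := FI.mem_mul h h
  have h9 : FI.mem ((275 : ℤ) / (6144 : ℕ) : ℝ) (FI.ofFrac 275 6144) := FI.mem_ofFrac 275 (by norm_num)
  have h7 := FI.mem_add (FI.mem_ofFrac (-99) (q := 128) (by norm_num)) (FI.mem_mul hw2 h9)
  have h5 := FI.mem_add (FI.mem_ofFrac 693 (q := 128) (by norm_num)) (FI.mem_mul hw2 h7)
  have h3 := FI.mem_add (FI.mem_ofFrac (-385) (q := 16) (by norm_num)) (FI.mem_mul hw2 h5)
  have h2 := FI.mem_add (FI.mem_ofFrac 99 (q := 4) (by norm_num)) (FI.mem_mul h h3)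
  have hs := FI.mem_add (FI.mem_ofFrac (-11) (q := 3) (by norm_num)) (FI.mem_mul hw2 h2)
  have hfin := FI.mem_divNat (FI.mem_mulInt hs 5) (n := 4) (by norm_num)
  have e : (-(11 : ℤ) : ℝ) / (3 : ℕ) + w * w * ((99 : ℤ) / (4 : ℕ) + w * ((-(385 : ℤ) : ℝ) / (16 : ℕ) + w * w * ((693 : ℤ) / (128 : ℕ) +
      w * w * ((-(99 : ℤ) : ℝ) / (128 : ℕ) + w * w * ((275 : ℤ) / (6144 : ℕ)))))) =
      -(11 / 3) + 99 / 4 * w ^ 2 - 385 / 16 * w ^ 3 + 693 / 128 * w ^ 5 - 99 / 128 * w ^ 7 + 275 / 6144 * w ^ 9 := by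
    push_cast; ring
  have e2 : ((-(11 / 3) + 99 / 4 * w ^ 2 - 385 / 16 * w ^ 3 + 693 / 128 * w ^ 5 - 99 / 128 * w ^ 7 + 275 / 6144 * w ^ 9) * (5 : ℤ)) / (4 : ℕ) =
      5 / 4 * (-(11 / 3) + 99 / 4 * w ^ 2 - 385 / 16 * w ^ 3 + 693 / 128 * w ^ 5 - 99 / 128 * w ^ 7 + 275 / 6144 * w ^ 9) := by
    push_cast; ring
  rw [← e2, ← e]
  simpa [bumpP54FI] using hfin

/-! ## §3. Bump regime: `β` and `α` assembled from `q`, `q⁻¹`, `ρ = √q` -/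

/-- ★ `β` in the bump regime: `(q⁻¹)⁴ − (q⁻¹)⁷ − (3/160)·(5/4)·S(5ρ/4)` with `ρ = √q` enclosed by `FI.sqrt` (`none` iff `Q` reaches `0`). -/
def betaBumpFI (Q : FI) : Option FI :=
  match phiFI Q with
  | none => none
  | some P => some (P.sub (((bumpS54FI (wFI (FI.sqrt Q))).mulInt 3).divNat 160))

/-- ★ Soundness of `betaBumpFI` (real variable `ρ ≥ 0`, `q = ρ²`). [folklore] -/
theorem mem_betaBumpFI {ρ : ℝ} (hρ : 0 ≤ ρ) {Q B : FI} (hq : FI.mem (ρ ^ 2) Q) (h : betaBumpFI Q = some B) :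
    FI.mem (((ρ ^ 2)⁻¹) ^ 4 - ((ρ ^ 2)⁻¹) ^ 7 -
      3 / 160 * (5 / 4 * (-(11 / 3) + 33 / 4 * (5 * ρ / 4) ^ 2 - 385 / 64 * (5 * ρ / 4) ^ 3 + 231 / 256 * (5 * ρ / 4) ^ 5 -
        99 / 1024 * (5 * ρ / 4) ^ 7 + 55 / 12288 * (5 * ρ / 4) ^ 9))) B := by
  unfold betaBumpFI at h
  cases hphi : phiFI Q with
  | none => rw [hphi] at h; exact absurd h (by simp)
  | some P =>
    rw [hphi] at h
    simp only [Option.some.injEq] at h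
    subst h
    have hP := mem_phiFI hq hphi
    have hR : FI.mem ρ (FI.sqrt Q) := by
      have := FI.mem_sqrt hq
      rwa [Real.sqrt_sq hρ] at this
    have hS := mem_bumpS54FI (mem_wFI hR)
    have hS' := FI.mem_divNat (FI.mem_mulInt hS 3) (n := 160) (by norm_num)
    have e : 5 / 4 * (-(11 / 3) + 33 / 4 * (5 * ρ / 4) ^ 2 - 385 / 64 * (5 * ρ / 4) ^ 3 + 231 / 256 * (5 * ρ / 4) ^ 5 -
        99 / 1024 * (5 * ρ / 4) ^ 7 + 55 / 12288 * (5 * ρ / 4) ^ 9) * ((3 : ℤ) : ℝ) / ((160 : ℕ) : ℝ) =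
        3 / 160 * (5 / 4 * (-(11 / 3) + 33 / 4 * (5 * ρ / 4) ^ 2 - 385 / 64 * (5 * ρ / 4) ^ 3 + 231 / 256 * (5 * ρ / 4) ^ 5 -
        99 / 1024 * (5 * ρ / 4) ^ 7 + 55 / 12288 * (5 * ρ / 4) ^ 9)) := by
      push_cast; ring
    rw [e] at hS'
    exact FI.mem_sub hP hS'

/-- ★ `α` in the bump regime: `14(q⁻¹)⁸ − 8(q⁻¹)⁵ − (3/160)·((5/4)P₂(w) − (5/4)S(w))·q⁻¹`, `w = 5√q/4`. -/
def alphaBumpFI (Q : FI) : Option FI :=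
  match alphaLJFI Q, FI.divPos (FI.ofInt 1) Q with
  | some A, some u =>
    let W := wFI (FI.sqrt Q)
    some (A.sub (((((bumpP54FI W).sub (bumpS54FI W)).mul u).mulInt 3).divNat 160))
  | _, _ => none

/-- ★ Soundness of `alphaBumpFI`. [folklore] -/
theorem mem_alphaBumpFI {ρ : ℝ} (hρ : 0 ≤ ρ) {Q A : FI} (hq : FI.mem (ρ ^ 2) Q) (h : alphaBumpFI Q = some A) :
    FI.mem (14 * ((ρ ^ 2)⁻¹) ^ 8 - 8 * ((ρ ^ 2)⁻¹) ^ 5 -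
      3 / 160 * ((5 / 4 * (-(11 / 3) + 99 / 4 * (5 * ρ / 4) ^ 2 - 385 / 16 * (5 * ρ / 4) ^ 3 + 693 / 128 * (5 * ρ / 4) ^ 5 -
          99 / 128 * (5 * ρ / 4) ^ 7 + 275 / 6144 * (5 * ρ / 4) ^ 9) -
        5 / 4 * (-(11 / 3) + 33 / 4 * (5 * ρ / 4) ^ 2 - 385 / 64 * (5 * ρ / 4) ^ 3 + 231 / 256 * (5 * ρ / 4) ^ 5 -
          99 / 1024 * (5 * ρ / 4) ^ 7 + 55 / 12288 * (5 * ρ / 4) ^ 9)) * (ρ ^ 2)⁻¹)) A := by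
  unfold alphaBumpFI at h
  cases hA : alphaLJFI Q with
  | none => rw [hA] at h; exact absurd h (by simp)
  | some A0 =>
    cases hu : FI.divPos (FI.ofInt 1) Q with
    | none => rw [hA, hu] at h; exact absurd h (by simp)
    | some u =>
      rw [hA, hu] at h
      simp only [Option.some.injEq] at h
      subst h
      have hA0 := mem_alphaLJFI hq hA
      have huu : FI.mem ((ρ ^ 2)⁻¹) u := by
        have := FI.mem_divPos hu (by simpa using FI.mem_ofInt 1) hq
        simpa [one_div] using this
      have hR : FI.mem ρ (FI.sqrt Q) := by
        have := FI.mem_sqrt hq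
        rwa [Real.sqrt_sq hρ] at this
      have hW := mem_wFI hR
      have hD := FI.mem_mul (FI.mem_sub (mem_bumpP54FI hW) (mem_bumpS54FI hW)) huu
      have hD' := FI.mem_divNat (FI.mem_mulInt hD 3) (n := 160) (by norm_num)
      have key := FI.mem_sub hA0 hD'
      push_cast at key
      convert key using 1
      ring

end Summit.AtomisticToContinuum.Crystallization.Theorems.FrustratedLawDichotomyStrainedPatchHomCurvCoeff

end
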